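import Summits.BirchSwinnertonDyer.BirchSwinnertonDyer.Theorems.ErratumRoadFiveTwoVariableControl
import Summits.BirchSwinnertonDyer.BirchSwinnertonDyer.Theorems.ErratumRoadFiveTwoVariableControlDualFinite
import Summits.BirchSwinnertonDyer.BirchSwinnertonDyer.Theorems.ErratumRoadFiveSelmerTorsionControlFinite
import HarnessLib

/-!
# Two-variable CONTROL with FINITE defect ([JSW17, Lemma 3.4.1], general case) for the erratum's Selmer groups:
# `X^Σ_K(𝓜)/T_c ↠ X^Σ_ac(M)` with FINITE kernel and `X^Σ_K(𝓜)` finitely generated, from (glob) + (unr) + FINITENESS of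
# the local defect `𝓜^{Γ_{K_𝔮}}/T_c` at the strict prime (helper, `--supports stmt-BirchSwinnertonDyer-25505`)

Cell `bsd-stepL`, seat `bsd-stepL-imc-p1` (prover g22, 2026-08-28). Theorems only (no definition, no named fact, no
`sorry`, no instance, no notation). Assembles `ControlHom.exists_controlHom` (imc-p1 g21, p617763: the injective
`C`-semilinear `θ : Sel(M) ↪ Sel(𝓜)` with range `H¹(ι)(Sel(𝓜[T_c]))`, (glob) only), `SelmerFiniteDefect.finite_selmer_torsion_quot`
(g22: `Sel(𝓜)[T_c]/H¹(ι)(Sel(𝓜[T_c]))` finite from finite local `T_c`-cotorsion at the strict prime and divisible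
local invariants elsewhere) and `ControlDualFinite` (g22, p636684: Pontryagin dual with finite kernel; complete Nakayama).

## What is proved (for ANY number field `K`, `ℤ_p`-extensions `κ, κ'`, strict prime `𝔮`, set `Σ`)

Hypotheses: (glob) `A` has no non-zero `Γ_K`-fixed `p`-power torsion; (unr) `A` is unramified at every finite `w ∉ Σ`,
`w ∤ p`; (fin) the local defect at the strict prime is FINITE:
`Finite (QuotSMulTop T_c ↥((𝓜|_{Γ_{K_𝔮}})^{Γ_{K_𝔮}}))`, `𝓜 = AnticyclotomicBigGaloisRep κ' (AnticyclotomicBigGaloisRep κ ρ)`.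
((dec) ⟹ (fin) trivially: then the invariants vanish, p627206; on the anomalous corner `¬(dec)` (fin) still HOLDS —
memo `HOME/imc-p1/g22/CORNER-25505-imc-p1-g22.md` §2.4 — but is not proved in the tree.)

* `finite_index_range_controlHom` — the range of `θ` has finite index in `Sel(𝓜)[T_c]`.
* `exists_controlMap_of_finite_defect` — a `Λ`-linear SURJECTIVE `f : X^Σ(𝓜)/T_c → X^Σ(M)` with FINITE kernel.
* `module_finite_XBig_iterate_of_finite_defect` — `X^Σ(𝓜)` is finitely generated over `Λ⟦T_c⟧` if `X^Σ(M)` is over `Λ`.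

HONEST FRAMING: cohomological bookkeeping on the tree's carriers; conditional on nothing; nothing about BSD; closes: none (T7).

## References
* [JetchevSkinnerWan2017] §3.4, Lemma 3.4.1 and proof (arXiv:1512.06894 p. 14). [Castella2018Erratum] Lemma 2.1 (p. 2).
-/

noncomputable section

open CategoryTheory Field IsDedekindDomain NumberField
open Literature.NumberTheory.GaloisRepresentations Literature.NumberTheory.EllipticCurves
  Literature.NumberTheory.EllipticCurves.BigGaloisRep
  Summit.BirchSwinnertonDyer.Rank1Residual.X11b
open scoped ContRepresentation Pointwise

-- D-0017: single-problem summit, the namespace repeats the problem name by design.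
set_option linter.dupNamespace false
set_option autoImplicit false

namespace Summit.BirchSwinnertonDyer.BirchSwinnertonDyer.Theorems.ErratumThm23TwoVariable.ControlFiniteDefect

universe u

variable {K : Type u} [Field K] [NumberField K] {p : ℕ} [Fact p.Prime]
  {𝒪 : Type*} [CommRing 𝒪] [TopologicalSpace 𝒪]
  {A : Type u} [AddCommGroup A] [Module 𝒪 A] [TopologicalSpace A] [DiscreteTopology A]
  [TopologicalSpace (PowerSeries 𝒪)] [TopologicalSpace (PowerSeries (PowerSeries 𝒪))]
  [ContinuousSMul (PowerSeries 𝒪) (BigRepModule 𝒪 p A)]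
  [ContinuousSMul (PowerSeries (PowerSeries 𝒪))
    (BigRepModule (PowerSeries 𝒪) p (BigRepModule 𝒪 p A))]
  (κ κ' : ZpExtension K p) (ρ : ContinuousRep (absoluteGaloisGroup K) 𝒪 A)
  (𝔮 : HeightOneSpectrum (𝓞 K)) (S : Set (HeightOneSpectrum (𝓞 K)))

omit [ContinuousSMul (PowerSeries 𝒪) (BigRepModule 𝒪 p A)] in
/-- **`Sel^Σ_𝔮(K, 𝓜)[T_c] / H¹(ι)(Sel^Σ_𝔮(K, 𝓜[T_c]))` is finite** when the local defect at the strict prime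
`𝓜^{Γ_{K_𝔮}}/T_c` is finite and `A` is unramified off `Σ` (there the restricted iterate is trivial and `T_c` is onto,
so the local invariants are `T_c`-divisible — the (unr) branch of `ControlAt.hloc_iterate`).
[cite: JetchevSkinnerWan2017, §3.4, Lemma 3.4.1 (arXiv:1512.06894 p. 14)] -/
theorem finite_selmerBig_torsion_quot
    (hunr : ∀ w : HeightOneSpectrum (𝓞 K), w ∉ S → ((p : ℕ) : 𝓞 K) ∉ w.asIdeal →
      ∀ (σ : LocalGroup K (Sum.inr w)) (a : A), ρ (localMap K (Sum.inr w) σ) a = a)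
    (hfin : Finite (QuotSMulTop (PowerSeries.X : PowerSeries (PowerSeries 𝒪))
      ↥((((AnticyclotomicBigGaloisRep κ' (AnticyclotomicBigGaloisRep κ ρ)).restrict
        (localMap K (Sum.inl 𝔮))).toTopRep).ρ.invariants))) :
    Finite (↥(selmerBig κ' (AnticyclotomicBigGaloisRep κ ρ) 𝔮 S ⊓
        Submodule.torsionBy (PowerSeries (PowerSeries 𝒪))
          (continuousCohomology 1 (AnticyclotomicBigGaloisRep κ' (AnticyclotomicBigGaloisRep κ ρ)).toTopRep)
          PowerSeries.X) ⧸
      Submodule.comap (selmerBig κ' (AnticyclotomicBigGaloisRep κ ρ) 𝔮 S ⊓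
          Submodule.torsionBy (PowerSeries (PowerSeries 𝒪))
            (continuousCohomology 1 (AnticyclotomicBigGaloisRep κ' (AnticyclotomicBigGaloisRep κ ρ)).toTopRep)
            PowerSeries.X).subtype
        (Submodule.map (TorsionControl.torsionInclH1 (AnticyclotomicBigGaloisRep κ' (AnticyclotomicBigGaloisRep κ ρ))
            (PowerSeries.X : PowerSeries (PowerSeries 𝒪)))
          (TorsionControl.selmer (localMap K) (strictSet p 𝔮 S)
            (TorsionControl.torsionRep (AnticyclotomicBigGaloisRep κ' (AnticyclotomicBigGaloisRep κ ρ))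
              (PowerSeries.X : PowerSeries (PowerSeries 𝒪)))))) := by
  classical
  refine SelmerFiniteDefect.finite_selmer_torsion_quot (localMap K) (strictSet p 𝔮 S)
    (AnticyclotomicBigGaloisRep κ' (AnticyclotomicBigGaloisRep κ ρ)) PowerSeries.X
    ControlInputs.X_smul_surjective_iterate {Sum.inl 𝔮} (fun v hv ↦ ?_) (fun v hv hv₀ ↦ ?_) (fun v hv ↦ ?_)
  · rw [Finset.mem_singleton] at hv
    subst hv
    exact inl_self_mem_strictSet p 𝔮 S
  · -- off the strict prime: `v = Sum.inr w`, the restricted iterate is trivial and `T_c` is onto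
    rcases v with w | w
    · rw [inl_mem_strictSet_iff] at hv
      subst hv
      exact absurd (Finset.mem_singleton_self _) hv₀
    · rw [inr_mem_strictSet_iff] at hv
      intro x _
      obtain ⟨x', hx'⟩ := ControlInputs.X_smul_surjective_iterate (𝒪 := 𝒪) (p := p) (A := A) x
      refine ⟨x', ?_, hx'⟩
      have htop := BigRep.bigRep_restrict_invariants_eq_top (p := p) κ'.toContinuousMonoidHom
        (bigRep (p := p) κ.toContinuousMonoidHom ρ) (localMap K (Sum.inr w))
        (fun h ↦ by
          rw [ZpExtension.coe_toContinuousMonoidHom]; exact ZpExtension.apply_localMap_inr κ' hv.2 h)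
        (fun h m ↦ BigRep.bigRep_restrict_apply_eq_self κ.toContinuousMonoidHom ρ
          (localMap K (Sum.inr w))
          (fun h' ↦ by
            rw [ZpExtension.coe_toContinuousMonoidHom]; exact ZpExtension.apply_localMap_inr κ hv.2 h')
          (fun h' a ↦ hunr w hv.1 hv.2 h' a) h m)
      change x' ∈ (((bigRep κ'.toContinuousMonoidHom (bigRep κ.toContinuousMonoidHom ρ)).restrict
          (localMap K (Sum.inr w))).toTopRep).ρ.invariants
      rw [htop]
      exact Submodule.mem_top
  · rw [Finset.mem_singleton] at hv
    subst hv
    exact hfin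

set_option maxHeartbeats 800000 in
-- statement and bookkeeping over the iterated big representation (as `ControlAt.exists_controlMap`)
/-- **The range of the control injection `θ` has finite index in `Sel^Σ_𝔮(K, 𝓜)[T_c]`** (under (glob), (unr), (fin)):
`θ`'s range is `H¹(ι)(Sel(𝓜[T_c]))` (`ControlHom.exists_controlHom` (3)+(4)), so `Sel(𝓜)[T_c]/range θ` embeds into the
finite quotient of `finite_selmerBig_torsion_quot`. [cite: JetchevSkinnerWan2017, §3.4, Lemma 3.4.1 (arXiv:1512.06894 p. 14)] -/
theorem exists_controlHom_finite_index
    (hA : ∀ a : A, (∀ g : absoluteGaloisGroup K, ρ g a = a) → (∃ k : ℕ, p ^ k • a = 0) → a = 0)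
    (hunr : ∀ w : HeightOneSpectrum (𝓞 K), w ∉ S → ((p : ℕ) : 𝓞 K) ∉ w.asIdeal →
      ∀ (σ : LocalGroup K (Sum.inr w)) (a : A), ρ (localMap K (Sum.inr w) σ) a = a)
    (hfin : Finite (QuotSMulTop (PowerSeries.X : PowerSeries (PowerSeries 𝒪))
      ↥((((AnticyclotomicBigGaloisRep κ' (AnticyclotomicBigGaloisRep κ ρ)).restrict
        (localMap K (Sum.inl 𝔮))).toTopRep).ρ.invariants))) :
    ∃ θ : selmerBig κ ρ 𝔮 S →+ selmerBig κ' (AnticyclotomicBigGaloisRep κ ρ) 𝔮 S,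
      Function.Injective θ ∧
      (∀ (f : PowerSeries 𝒪) (s : selmerBig κ ρ 𝔮 S),
        θ (f • s) = (PowerSeries.C f : PowerSeries (PowerSeries 𝒪)) • θ s) ∧
      (∀ s, (PowerSeries.X : PowerSeries (PowerSeries 𝒪)) • θ s = 0) ∧
      Finite (↥(Submodule.torsionBy (PowerSeries (PowerSeries 𝒪))
          (selmerBig κ' (AnticyclotomicBigGaloisRep κ ρ) 𝔮 S) PowerSeries.X).toAddSubgroup ⧸
        (θ.range).addSubgroupOf (Submodule.torsionBy (PowerSeries (PowerSeries 𝒪))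
          (selmerBig κ' (AnticyclotomicBigGaloisRep κ ρ) 𝔮 S) PowerSeries.X).toAddSubgroup) := by
  classical
  obtain ⟨θ, hinj, hC, hmem, hsurj⟩ :
      ∃ θ : selmerBig κ ρ 𝔮 S →+ selmerBig κ' (AnticyclotomicBigGaloisRep κ ρ) 𝔮 S,
        Function.Injective θ ∧
        (∀ (f : PowerSeries 𝒪) (s : selmerBig κ ρ 𝔮 S),
          θ (f • s) = (PowerSeries.C f : PowerSeries (PowerSeries 𝒪)) • θ s) ∧
        (∀ s, ((θ s : selmerBig κ' (AnticyclotomicBigGaloisRep κ ρ) 𝔮 S) :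
            continuousCohomology 1 (AnticyclotomicBigGaloisRep κ' (AnticyclotomicBigGaloisRep κ ρ)).toTopRep) ∈
          Submodule.map (TorsionControl.torsionInclH1 (AnticyclotomicBigGaloisRep κ' (AnticyclotomicBigGaloisRep κ ρ))
              (PowerSeries.X : PowerSeries (PowerSeries 𝒪)))
            (TorsionControl.selmer (localMap K) (strictSet p 𝔮 S)
              (TorsionControl.torsionRep (AnticyclotomicBigGaloisRep κ' (AnticyclotomicBigGaloisRep κ ρ))
                (PowerSeries.X : PowerSeries (PowerSeries 𝒪))))) ∧
        (∀ y : selmerBig κ' (AnticyclotomicBigGaloisRep κ ρ) 𝔮 S,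
          (y : continuousCohomology 1 (AnticyclotomicBigGaloisRep κ' (AnticyclotomicBigGaloisRep κ ρ)).toTopRep) ∈
            Submodule.map (TorsionControl.torsionInclH1 (AnticyclotomicBigGaloisRep κ' (AnticyclotomicBigGaloisRep κ ρ))
                (PowerSeries.X : PowerSeries (PowerSeries 𝒪)))
              (TorsionControl.selmer (localMap K) (strictSet p 𝔮 S)
                (TorsionControl.torsionRep (AnticyclotomicBigGaloisRep κ' (AnticyclotomicBigGaloisRep κ ρ))
                  (PowerSeries.X : PowerSeries (PowerSeries 𝒪)))) →
          y ∈ Set.range θ) :=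
    ControlHom.exists_controlHom (localMap K) (strictSet p 𝔮 S) κ'.toContinuousMonoidHom
      κ.toContinuousMonoidHom ρ hA
  have hX : ∀ s, (PowerSeries.X : PowerSeries (PowerSeries 𝒪)) • θ s = 0 := by
    intro s
    obtain ⟨x, -, hx⟩ := hmem s
    have h := TorsionControl.smul_cohomologyMap_torsionIncl
      (AnticyclotomicBigGaloisRep κ' (AnticyclotomicBigGaloisRep κ ρ))
      (PowerSeries.X : PowerSeries (PowerSeries 𝒪)) x
    rw [← TorsionControl.torsionInclH1_apply, hx] at h
    exact Subtype.ext h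
  refine ⟨θ, hinj, hC, hX, ?_⟩
  -- the finite quotient `Sel(𝓜)[T_c] / H¹(ι)(Sel(𝓜[T_c]))`
  haveI hQ := finite_selmerBig_torsion_quot κ κ' ρ 𝔮 S hunr hfin
  set S' := selmerBig κ' (AnticyclotomicBigGaloisRep κ ρ) 𝔮 S ⊓
      Submodule.torsionBy (PowerSeries (PowerSeries 𝒪))
        (continuousCohomology 1 (AnticyclotomicBigGaloisRep κ' (AnticyclotomicBigGaloisRep κ ρ)).toTopRep)
        PowerSeries.X with hS'
  set I := Submodule.comap S'.subtype
      (Submodule.map (TorsionControl.torsionInclH1 (AnticyclotomicBigGaloisRep κ' (AnticyclotomicBigGaloisRep κ ρ))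
          (PowerSeries.X : PowerSeries (PowerSeries 𝒪)))
        (TorsionControl.selmer (localMap K) (strictSet p 𝔮 S)
          (TorsionControl.torsionRep (AnticyclotomicBigGaloisRep κ' (AnticyclotomicBigGaloisRep κ ρ))
            (PowerSeries.X : PowerSeries (PowerSeries 𝒪))))) with hI
  set T : AddSubgroup (selmerBig κ' (AnticyclotomicBigGaloisRep κ ρ) 𝔮 S) :=
    (Submodule.torsionBy (PowerSeries (PowerSeries 𝒪))
      (selmerBig κ' (AnticyclotomicBigGaloisRep κ ρ) 𝔮 S) PowerSeries.X).toAddSubgroup with hT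
  -- `T → S'` (same underlying class), then to the quotient
  have hmemS' : ∀ t : T, ((t : selmerBig κ' (AnticyclotomicBigGaloisRep κ ρ) 𝔮 S) :
      continuousCohomology 1 (AnticyclotomicBigGaloisRep κ' (AnticyclotomicBigGaloisRep κ ρ)).toTopRep) ∈ S' := by
    intro t
    have ht : (PowerSeries.X : PowerSeries (PowerSeries 𝒪)) •
        (t : selmerBig κ' (AnticyclotomicBigGaloisRep κ ρ) 𝔮 S) = 0 :=
      (Submodule.mem_torsionBy_iff _ _).1 t.2
    exact Submodule.mem_inf.2 ⟨(t : selmerBig κ' (AnticyclotomicBigGaloisRep κ ρ) 𝔮 S).2,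
      (Submodule.mem_torsionBy_iff _ _).2 (congrArg Subtype.val ht)⟩
  let g₀ : T →+ ↥S' :=
    { toFun := fun t ↦ ⟨((t : selmerBig κ' (AnticyclotomicBigGaloisRep κ ρ) 𝔮 S) :
          continuousCohomology 1 (AnticyclotomicBigGaloisRep κ' (AnticyclotomicBigGaloisRep κ ρ)).toTopRep), hmemS' t⟩
      map_zero' := rfl
      map_add' := fun _ _ ↦ rfl }
  let g₁ : T →+ (↥S' ⧸ I) := (I.mkQ).toAddMonoidHom.comp g₀
  -- kernel of `g₁` is `range θ`: (3) and (4) of `ControlHom.exists_controlHom`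
  have hker : ∀ t : T, g₁ t = 0 ↔ t ∈ (θ.range).addSubgroupOf T := by
    intro t
    rw [AddSubgroup.mem_addSubgroupOf, AddMonoidHom.mem_range]
    change I.mkQ (g₀ t) = 0 ↔ _
    rw [Submodule.mkQ_apply, Submodule.Quotient.mk_eq_zero, hI, Submodule.mem_comap, Submodule.subtype_apply]
    constructor
    · intro ht
      obtain ⟨s, hs⟩ := hsurj (t : selmerBig κ' (AnticyclotomicBigGaloisRep κ ρ) 𝔮 S) ht
      exact ⟨s, hs⟩
    · rintro ⟨s, hs⟩
      have h3 := hmem s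
      rw [hs] at h3
      exact h3
  let g : T ⧸ (θ.range).addSubgroupOf T →+ (↥S' ⧸ I) :=
    QuotientAddGroup.lift ((θ.range).addSubgroupOf T) g₁ fun t ht ↦ (hker t).2 ht
  refine Finite.of_injective g fun q₁ q₂ h ↦ ?_
  induction q₁ using QuotientAddGroup.induction_on with
  | H t₁ =>
    induction q₂ using QuotientAddGroup.induction_on with
    | H t₂ =>
      rw [QuotientAddGroup.eq_iff_sub_mem]
      have h' : g₁ (t₁ - t₂) = 0 := by
        rw [map_sub, sub_eq_zero]
        exact h
      exact (hker _).1 h'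

set_option maxHeartbeats 800000 in
-- statement-sized packages over the iterated big representation (as `ControlAt.exists_controlMap`); the proof is glue
/-- **Two-variable control with FINITE defect** ([JSW17, Lemma 3.4.1]: "the kernel of the surjection
`X^Σ_{Gr}(𝓜)/(γ₊ − 1)X^Σ_{Gr}(𝓜) ↠ X^Σ_{ac}(M)` has finite order"). Under (glob), (unr) and the FINITENESS of the local
defect `𝓜^{Γ_{K_𝔮}}/T_c` at the strict prime: a `Λ`-linear `f : X^Σ(𝓜)/T_c → X^Σ(M)` (quotient a `Λ`-module through `C`),
SURJECTIVE, with FINITE kernel. [cite: JetchevSkinnerWan2017, Lemma 3.4.1 (arXiv:1512.06894 p. 14)] [cite: Castella2018Erratum, Lemma 2.1 (p. 2)] -/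
theorem exists_controlMap_of_finite_defect
    (hA : ∀ a : A, (∀ g : absoluteGaloisGroup K, ρ g a = a) → (∃ k : ℕ, p ^ k • a = 0) → a = 0)
    (hunr : ∀ w : HeightOneSpectrum (𝓞 K), w ∉ S → ((p : ℕ) : 𝓞 K) ∉ w.asIdeal →
      ∀ (σ : LocalGroup K (Sum.inr w)) (a : A), ρ (localMap K (Sum.inr w) σ) a = a)
    (hfin : Finite (QuotSMulTop (PowerSeries.X : PowerSeries (PowerSeries 𝒪))
      ↥((((AnticyclotomicBigGaloisRep κ' (AnticyclotomicBigGaloisRep κ ρ)).restrict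
        (localMap K (Sum.inl 𝔮))).toTopRep).ρ.invariants))) :
    ∃ f : (letI : _root_.Module (PowerSeries 𝒪)
              (QuotSMulTop (PowerSeries.X : PowerSeries (PowerSeries 𝒪))
                (XBig κ' (AnticyclotomicBigGaloisRep κ ρ) 𝔮 S)) :=
            Module.compHom _ (PowerSeries.C (R := PowerSeries 𝒪))
          QuotSMulTop (PowerSeries.X : PowerSeries (PowerSeries 𝒪))
              (XBig κ' (AnticyclotomicBigGaloisRep κ ρ) 𝔮 S) →ₗ[PowerSeries 𝒪] XBig κ ρ 𝔮 S),
      Function.Surjective f ∧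
      (letI : _root_.Module (PowerSeries 𝒪)
            (QuotSMulTop (PowerSeries.X : PowerSeries (PowerSeries 𝒪))
              (XBig κ' (AnticyclotomicBigGaloisRep κ ρ) 𝔮 S)) :=
          Module.compHom _ (PowerSeries.C (R := PowerSeries 𝒪))
       Finite (LinearMap.ker f)) := by
  obtain ⟨θ, hinj, hC, hX, hfinT⟩ := exists_controlHom_finite_index κ κ' ρ 𝔮 S hA hunr hfin
  obtain ⟨f, hfs, -, hker⟩ := ControlDualFinite.exists_quotSMulTop_linearMap_of_finite_index
    (PowerSeries.C (R := PowerSeries 𝒪)) (PowerSeries.X : PowerSeries (PowerSeries 𝒪)) θ hC hX hinj hfinT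
  exact ⟨f, hfs, hker⟩

set_option maxHeartbeats 800000 in
-- as above
/-- **`X^Σ(𝓜)` is finitely generated over `Λ⟦T_c⟧`** when `X^Σ(M)` is over `Λ`, under (glob), (unr), (fin) — complete
Nakayama with finite defect (`ControlDualFinite.module_finite_characterModule_of_finite_index`).
[cite: JetchevSkinnerWan2017, §3.4 (arXiv:1512.06894 p. 14, "a finite Λ_K-module")] -/
theorem module_finite_XBig_iterate_of_finite_defect
    (hA : ∀ a : A, (∀ g : absoluteGaloisGroup K, ρ g a = a) → (∃ k : ℕ, p ^ k • a = 0) → a = 0)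
    (hunr : ∀ w : HeightOneSpectrum (𝓞 K), w ∉ S → ((p : ℕ) : 𝓞 K) ∉ w.asIdeal →
      ∀ (σ : LocalGroup K (Sum.inr w)) (a : A), ρ (localMap K (Sum.inr w) σ) a = a)
    (hfin : Finite (QuotSMulTop (PowerSeries.X : PowerSeries (PowerSeries 𝒪))
      ↥((((AnticyclotomicBigGaloisRep κ' (AnticyclotomicBigGaloisRep κ ρ)).restrict
        (localMap K (Sum.inl 𝔮))).toTopRep).ρ.invariants)))
    [Module.Finite (PowerSeries 𝒪) (XBig κ ρ 𝔮 S)] :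
    Module.Finite (PowerSeries (PowerSeries 𝒪)) (XBig κ' (AnticyclotomicBigGaloisRep κ ρ) 𝔮 S) := by
  obtain ⟨θ, hinj, hC, hX, hfinT⟩ := exists_controlHom_finite_index κ κ' ρ 𝔮 S hA hunr hfin
  refine ControlDualFinite.module_finite_characterModule_of_finite_index (PowerSeries.C (R := PowerSeries 𝒪))
    (PowerSeries.X : PowerSeries (PowerSeries 𝒪)) θ hC hX hinj hfinT fun y ↦ ?_
  obtain ⟨n, hn⟩ := BigGaloisRep.exists_pow_smul_eq_zero
    (AnticyclotomicBigGaloisRep κ' (AnticyclotomicBigGaloisRep κ ρ)).toTopRep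
    (PowerSeries.X : PowerSeries (PowerSeries 𝒪)) BigRepModule.exists_X_pow_smul_eq_zero
    (y : continuousCohomology 1 (AnticyclotomicBigGaloisRep κ' (AnticyclotomicBigGaloisRep κ ρ)).toTopRep)
  exact ⟨n, Subtype.ext (by rw [Submodule.coe_smul, hn, Submodule.coe_zero])⟩

end Summit.BirchSwinnertonDyer.BirchSwinnertonDyer.Theorems.ErratumThm23TwoVariable.ControlFiniteDefect

end
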